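import Summits.HodgeConjecture.HodgeConjecture.Theorems.EightfoldBlochSeedsBlochSeedsGenericPad4WeilClassSupported
import HarnessLib

/-!
# Route `EightfoldBlochSeeds`, crux `BlochSeedDiscThree` (item stmt-HodgeConjecture-18882), line `pad4-cm-anchor`
# (`Cruxes/BlochSeedDiscThree/Lines/pad4_cm_anchor.lean` d208bf462bd6e07f), stub `stub_pad4_carrier` at `d = 3`:
# the carrier stub's shape WITH A CLOSED SUPPORT holds on every `√-3`-anchor `S⁴(E₀)`

HONEST FRAMING. Nothing here proves the stub, the crux `BlochSeedDiscThree`, rung H2, HC_AV or the Hodge conjecture; nothing is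
constructed. UNCONDITIONAL `--supports` lemma (no named fact as hypothesis, no definition, no Literature fact; D-0026). Census-neutral.

WHAT IS HERE (leafhand `leafhand-hodge-eightfoldblochseed-1-g1`). The `d = 3` instance, in the binder order of the registered stub
`stub_pad4_carrier (E₀) (ψ₀) (hE) (hψ : ψ₀ ≫ ψ₀ = -(3 • 𝟙 E₀))`, of the `d`-uniform theorem
`exists_pad4_carrierShape_closedSupport` (file `…BlochSeedsGenericPad4WeilClassSupported`, item 18880): for every CM datum with
`ψ₀² = -3` (`ℂ/ℤ[ζ₃]` with `√-3 = 1 + 2ζ₃`, or `ℂ/ℤ[√-3]`) there are a projective embedding `e` of `S⁴ = ((S × S) × S) × S`, `S = E₀ × E₀`, a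
rational `a ≠ 0` with `(S⁴, Ψ)`, `Ψ = (ψ₀ × (−ψ₀))⁴`, hyperbolic for `h_K = 3·e^*a + Ψ^*e^*a`, a non-zero rational `w` of the `ℚ(√-3)`-Weil
plane, and for every `q ∈ ℚ` ONE Zariski-closed `Y ⊂ S⁴` of codimension `≥ 4` supporting `q·h_K⁴ + w`. The stub asks for that support
to be an INTEGRAL local complete intersection of codimension `4` (then, by purity — not in the tree — `cl(Z) ∈ ℚ·h_K⁴ ⊕ W_K` with
non-zero Weil part and `q ≠ 0`); that, and nothing else, is open (inputs (L-Port), (L-BK-deg), (L-FL-deg) and a Weil-bearing locally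
free module — census of the `d = 1` hand, uniform in `d`).

## References

[cite: vanGeemen1994HodgeAV, Thm. 4.3, Lemma 5.2, 5.3–5.4] [cite: Fulton1998, §19.1 Lemma 19.1.1] [cite: Schoen1988HodgeWeil, §3]
-/

noncomputable section

-- single-problem summit (Problem = Summit): the mandated namespace repeats `HodgeConjecture`.
set_option linter.dupNamespace false

open CategoryTheory AlgebraicGeometry
open Literature.AlgebraicGeometry Literature.AlgebraicGeometry.Motives Literature.AlgebraicGeometry.HodgeTheory
open Literature.AlgebraicTopology.SingularHomology

namespace Summit.HodgeConjecture.HodgeConjecture.Theorems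

/-- **The `d = 3` carrier stub's shape with a closed support, every `√-3` CM datum** (stub binder order; `Ψ` = the skeleton's
`pad4Action E₀ ψ₀`, `hΨ` by `rfl`): `e`, rational `a ≠ 0`, hyperbolicity for `h_K = 3·e^*a + Ψ^*e^*a`, a non-zero rational Weil class `w`
for `K = ℚ(√-3)`, and for every `q` a Zariski-closed codimension-`≥ 4` support of `q·h_K⁴ + w` — the instance `d := 3` of
`exists_pad4_carrierShape_closedSupport`. [cite: vanGeemen1994HodgeAV, Thm. 4.3 and 5.3] [cite: Fulton1998, §19.1 Lemma 19.1.1] -/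
theorem exists_pad4_carrierShape_closedSupport_discThree (E₀ : AbelianVariety ℂ) (ψ₀ : E₀ ⟶ E₀) (hE : E₀.dim = 1)
    (hψ : ψ₀ ≫ ψ₀ = -(3 • 𝟙 E₀))
    (Ψ : (((E₀.prod E₀).prod (E₀.prod E₀)).prod (E₀.prod E₀)).prod (E₀.prod E₀) ⟶
      (((E₀.prod E₀).prod (E₀.prod E₀)).prod (E₀.prod E₀)).prod (E₀.prod E₀))
    (hΨ : Ψ = AbelianVariety.prodLift
        (AbelianVariety.fst (((E₀.prod E₀).prod (E₀.prod E₀)).prod (E₀.prod E₀)) (E₀.prod E₀) ≫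
          AbelianVariety.prodLift
            (AbelianVariety.fst ((E₀.prod E₀).prod (E₀.prod E₀)) (E₀.prod E₀) ≫
              AbelianVariety.prodLift
                (AbelianVariety.fst (E₀.prod E₀) (E₀.prod E₀) ≫
                  AbelianVariety.prodLift (AbelianVariety.fst E₀ E₀ ≫ ψ₀) (AbelianVariety.snd E₀ E₀ ≫ (-ψ₀)))
                (AbelianVariety.snd (E₀.prod E₀) (E₀.prod E₀) ≫
                  AbelianVariety.prodLift (AbelianVariety.fst E₀ E₀ ≫ ψ₀) (AbelianVariety.snd E₀ E₀ ≫ (-ψ₀))))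
            (AbelianVariety.snd ((E₀.prod E₀).prod (E₀.prod E₀)) (E₀.prod E₀) ≫
              AbelianVariety.prodLift (AbelianVariety.fst E₀ E₀ ≫ ψ₀) (AbelianVariety.snd E₀ E₀ ≫ (-ψ₀))))
        (AbelianVariety.snd (((E₀.prod E₀).prod (E₀.prod E₀)).prod (E₀.prod E₀)) (E₀.prod E₀) ≫
          AbelianVariety.prodLift (AbelianVariety.fst E₀ E₀ ≫ ψ₀) (AbelianVariety.snd E₀ E₀ ≫ (-ψ₀)))) :
    ∃ (e : ProjectiveEmbedding ((((E₀.prod E₀).prod (E₀.prod E₀)).prod (E₀.prod E₀)).prod (E₀.prod E₀)).X)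
      (a : complexBetti (projectiveSpace e.n ℂ) 2)
      (w : complexBetti ((((E₀.prod E₀).prod (E₀.prod E₀)).prod (E₀.prod E₀)).prod (E₀.prod E₀)).X (2 * 4)),
      IsRationalClass a ∧ a ≠ 0 ∧
      IsHyperbolicWeilType _ Ψ 4
        (((3 : ℕ) : ℂ) • complexBetti.map e.ι 2 a + complexBetti.map Ψ.hom.hom.hom 2 (complexBetti.map e.ι 2 a)) ∧
      w ∈ weilClassesOf _ Ψ 4 3 ∧ IsRationalClass w ∧ w ≠ 0 ∧
      ∀ q : ℚ, ∃ Y : Set ((((E₀.prod E₀).prod (E₀.prod E₀)).prod (E₀.prod E₀)).prod (E₀.prod E₀)).X.left,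
        IsClosed Y ∧ (∀ y ∈ Y, (4 : ℕ∞) ≤ Order.coheight y) ∧
        ((q : ℚ) : ℂ) •
              cupPowTwo (((3 : ℕ) : ℂ) • complexBetti.map e.ι 2 a + complexBetti.map Ψ.hom.hom.hom 2 (complexBetti.map e.ι 2 a)) 4 +
            w ∈
          classesSupportedOn ((((E₀.prod E₀).prod (E₀.prod E₀)).prod (E₀.prod E₀)).prod (E₀.prod E₀)).X Y (2 * 4) :=
  exists_pad4_carrierShape_closedSupport (d := 3) (by norm_num) hE hψ Ψ hΨ

end Summit.HodgeConjecture.HodgeConjecture.Theorems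

end
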